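import Literature.Algebra.EuclideanLattices.KhotReduction
import Literature.Algebra.EuclideanLattices.KhotGapInstancesBCH
import HarnessLib

/-!
# Khot 2005, Thm. 1.1 (constant factors, `p = 2`): polynomial sizes, the coin budget discharged, and ONE explicit output map per number of levels

Topic `Algebra/EuclideanLattices`, namespace `Literature.Algebra.EuclideanLattices.Khot` (sub-namespace
`Params` for parameters). Companion of `KhotReduction.lean`, which proved
`gapSVP_const_isNPHardRandomized` from `AroraEtAl1997_prop6` (PCP) and the machine hypothesis
"`∀ k, ∃ Δ F Q, F ∈ FP ∧ (coins read ≤ Q(|code I|) on the guard) ∧ F ⟨code I, c⟩ = code (khotOutput k Δ I c)`".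
This file removes everything from that hypothesis except the running time of ONE completely
specified map:

1. **All sizes are polynomial in the code length** (§7.3 "the reduction runs in time `n^{O(k²)}`",
   size part). For `u, σ, K ≤ n`, `K ≥ 1`: `M' ≤ α_k log₂ n + β_k` (`M'_le`; the delicate point —
   `M'` contains `(log₂ A + 1)/(K+1)` with `log₂ A = K·O(k log n) + O(log n)`, and the division by
   `K + 1` makes `N = 2^{2M'}` a polynomial of degree `O(k)`, `NN_le`), `rows ≤ ρ_k n^{2α_k+2}`,
   `s ≤ s_k n⁴`, `D ≤ (40 s_k)^{k+1} n^{5(k+1)}`, `log₂ q₂ ≤ λ_k n (log₂ n + 1)` (`lq_le_poly`),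
   `L₀ ≤ L_k n^{2α_k+5}` (`L₀_le_poly`); on the guard `u, m, K ≤ |code I|` (`guard_sizes_le`: every
   member of a `listBool` code costs `≥ 2` bits, and the covering clause lists every element of the
   universe), whence `exists_coinBudget` and the final theorem WITHOUT the coin-budget clause
   (`gapSVP_const_isNPHardRandomized_of_prop6_of_FP'`).
2. **The explicit data** `khotDataExplicit k : KhotData k`: `P := khotBCH u σ K k`
   (`KhotGapInstancesBCH.lean`: the binary BCH parity-check matrix over `𝔽₂[X]/(canonIrred M)`,
   `BCHExplicit.lean`; `khotBCH_entry`, `khotBCH_dwise`) and explicit enumerations of the recursive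
   index types of the boosted matrix (`Coef`, `Out` of `KhotTensorBoost.lean`, the padding rows
   `augPad` of `KhotRecoverable.lean`): `coefEquivFin`, `outEquivFin`, `padEquivFin` (mixed radix /
   concatenation via `finProdFinEquiv`, `finSumFinEquiv`) over the base enumerations
   `rowsUnitEquivFin` (`idxR`, then the extra row), `colsEquivFin`, `basePadEquivFin` (universe rows
   `e ≠ 0`, shifted down by one); the explicit map `khotOutputExplicit k := khotOutput k (khotDataExplicit k)`.
3. **The final statements** (`promiseRandReducible_gapSetCover_gapSVP_of_FP_explicit`,
   `gapSVP_const_isNPHardRandomized_of_prop6_of_FP_explicit`): the target fact follows from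
   `AroraEtAl1997_prop6` and "for every `k` some `F ∈ FP` satisfies
   `F ⟨code I, c⟩ = code (khotOutputExplicit k I c)` for all `I`, `c`" — the only remaining
   (machine-level, TM2) obligation of the cone of `gapSVP_const_isNPHardRandomized`.

## References

* S. Khot, *Hardness of approximating the shortest vector problem in lattices*, J. ACM 52 (2005)
  789–808, Thm. 1.1, Thm. 4.1, Thm. 5.1 (1) ("The reduction runs in time polynomial in `N`"), §6,
  §7.3.
* S. Arora, B. Barak, *Computational Complexity: A Modern Approach*, CUP 2009, §0.1 (lengths of
  codes of numbers, pairs and lists).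
-/

noncomputable section

open Computability Literature.Computability.Complexity Literature.Computability.MetaComplexity
  Literature.Computability.Complexity.PromiseProblem Literature.Algebra.EuclideanLattices

namespace Literature.Algebra.EuclideanLattices.Khot

open Matrix Finset

/-! ### Logarithm bookkeeping -/

section Log

/-- `log₂ (x·y) ≤ log₂ x + log₂ y + 1`. DELIBERATE DUPLICATE (same statement) of
`Literature.Computability.Complexity.log_mul_le` of `Computability/Complexity/MurrayWilliams2018Lemma13.lean`:
that Murray–Williams-specific circuit-lower-bound file is not in, and should not enter, the import
closure of the lattice files for a 12-line lemma; the natural shared home of both copies is a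
`Nat.log` helper next to `BoolEncodings.bitsToNat` (librarian consolidation candidate).
[folklore] -/
theorem log2_mul_le (x y : ℕ) : Nat.log 2 (x * y) ≤ Nat.log 2 x + Nat.log 2 y + 1 := by
  rcases Nat.eq_zero_or_pos x with rfl | hx
  · simp
  rcases Nat.eq_zero_or_pos y with rfl | hy
  · simp
  have h1 : x < 2 ^ (Nat.log 2 x + 1) := Nat.lt_pow_succ_log_self (by norm_num) x
  have h2 : y < 2 ^ (Nat.log 2 y + 1) := Nat.lt_pow_succ_log_self (by norm_num) y
  have h3 : x * y < 2 ^ (Nat.log 2 x + Nat.log 2 y + 2) := by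
    calc x * y < 2 ^ (Nat.log 2 x + 1) * 2 ^ (Nat.log 2 y + 1) :=
          Nat.mul_lt_mul_of_lt_of_le h1 h2.le (by positivity)
      _ = 2 ^ (Nat.log 2 x + Nat.log 2 y + 2) := by rw [← pow_add]; ring_nf
  have h4 : Nat.log 2 (x * y) < Nat.log 2 x + Nat.log 2 y + 2 :=
    (Nat.log_lt_iff_lt_pow (by norm_num) (Nat.mul_ne_zero hx.ne' hy.ne')).2 h3
  omega

/-- `log₂ (x^e) ≤ e·(log₂ x + 1)`. [folklore] -/
theorem log2_pow_le (x : ℕ) : ∀ e : ℕ, Nat.log 2 (x ^ e) ≤ e * (Nat.log 2 x + 1)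
  | 0 => by simp
  | e + 1 => by
    rw [pow_succ]
    have := log2_mul_le (x ^ e) x
    have := log2_pow_le x e
    nlinarith

/-- `log₂ x ≤ log₂ c + log₂ n + 1` for `x ≤ c·n`. [folklore] -/
theorem log2_le_of_le_mul {x c n : ℕ} (h : x ≤ c * n) : Nat.log 2 x ≤ Nat.log 2 c + Nat.log 2 n + 1 :=
  (Nat.log_mono_right h).trans (log2_mul_le c n)

end Log

/-! ### The parameters are polynomial -/

namespace Params

variable {u σ K k n : ℕ}

/-- The slope of the bound `M' ≤ α·log₂ n + β`. [cite: Khot2005, §7.3] -/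
def αk (k : ℕ) : ℕ := 40 * k + 53

/-- The intercept of the bound `M' ≤ α·log₂ n + β`. [cite: Khot2005, §7.3] -/
def βk (k : ℕ) : ℕ := 400 * (k + 1) ^ 2 + 280 * k + 415

/-- `log₂ S₀ ≤ 3 log₂ n + 20` (`S₀ ≤ 2¹⁶ n³`). [folklore] -/
theorem log2_S₀_le (hK1 : 1 ≤ K) (hKn : K ≤ n) : Nat.log 2 (S₀ K) ≤ 3 * Nat.log 2 n + 20 := by
  have hS : S₀ K ≤ 2 ^ 16 * n ^ 3 := by
    unfold S₀
    have : 1 ≤ n := hK1.trans hKn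
    nlinarith [Nat.pow_le_pow_left hKn 2, Nat.pow_le_pow_left hKn 3, pow_pos (show 0 < n by omega) 2]
  have h1 := log2_le_of_le_mul hS
  rw [Nat.log_pow (by norm_num)] at h1
  have h2 := log2_pow_le n 3
  omega

/-- `log₂ D₀ ≤ (4k+1) log₂ n + 28k + 8`. [folklore] -/
theorem log2_D₀_le (hK1 : 1 ≤ K) (hKn : K ≤ n) :
    Nat.log 2 (D₀ K k) ≤ (4 * k + 1) * Nat.log 2 n + 28 * k + 8 := by
  unfold D₀
  have h1 := log2_mul_le (S₀ K ^ k) ((40 * K) ^ (k + 1))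
  have h2 := log2_pow_le (S₀ K) k
  have h3 := log2_pow_le (40 * K) (k + 1)
  have h4 := log2_S₀_le hK1 hKn
  have h5 : Nat.log 2 (40 * K) ≤ Nat.log 2 n + 6 := by
    have := log2_le_of_le_mul (show 40 * K ≤ 40 * n from Nat.mul_le_mul_left 40 hKn)
    have h40 : Nat.log 2 40 = 5 := by decide
    omega
  have h6 : k * (Nat.log 2 (S₀ K) + 1) ≤ k * (3 * Nat.log 2 n + 21) := Nat.mul_le_mul_left k (by omega)
  have h7 : (k + 1) * (Nat.log 2 (40 * K) + 1) ≤ (k + 1) * (Nat.log 2 n + 7) := Nat.mul_le_mul_left _ (by omega)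
  nlinarith

/-- `log₂ A ≤ 33 + log₂ n + K·((40k+51) log₂ n + 280k + 376)`. [folklore] -/
theorem log2_A_le (hK1 : 1 ≤ K) (hKn : K ≤ n) (hu : u ≤ n) (hσ : σ ≤ n) :
    Nat.log 2 (A u σ K k) ≤ 33 + Nat.log 2 n + K * ((40 * k + 51) * Nat.log 2 n + 280 * k + 376) := by
  have hn : 1 ≤ n := hK1.trans hKn
  -- the seven factors
  have f1 : Nat.log 2 (2 * 10 ^ 8) ≤ 27 := by
    have : Nat.log 2 (2 * 10 ^ 8) < 28 := (Nat.log_lt_iff_lt_pow (by norm_num) (by norm_num)).2 (by norm_num)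
    omega
  have f2 : Nat.log 2 K ≤ Nat.log 2 n := Nat.log_mono_right hKn
  have f3 : Nat.log 2 (2 ^ (20 * K)) = 20 * K := Nat.log_pow (by norm_num) _
  have f4 : Nat.log 2 ((31 * K) ^ (31 * K)) ≤ 31 * K * (Nat.log 2 n + 6) := by
    have h := log2_pow_le (31 * K) (31 * K)
    have h' : Nat.log 2 (31 * K) ≤ Nat.log 2 n + 5 := by
      have := log2_le_of_le_mul (show 31 * K ≤ 31 * n from Nat.mul_le_mul_left 31 hKn)
      have h31 : Nat.log 2 31 = 4 := by decide
      omega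
    exact h.trans (Nat.mul_le_mul_left _ (by omega))
  have f5 : Nat.log 2 ((u + σ + 40 * K + 1) ^ (10 * K)) ≤ 10 * K * (Nat.log 2 n + 7) := by
    have h := log2_pow_le (u + σ + 40 * K + 1) (10 * K)
    have h' : Nat.log 2 (u + σ + 40 * K + 1) ≤ Nat.log 2 n + 6 := by
      have := log2_le_of_le_mul (show u + σ + 40 * K + 1 ≤ 43 * n by omega)
      have h43 : Nat.log 2 43 = 5 := by decide
      omega
    exact h.trans (Nat.mul_le_mul_left _ (by omega))
  have f6 : Nat.log 2 (2 ^ (10 * K)) = 10 * K := Nat.log_pow (by norm_num) _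
  have f7 : Nat.log 2 (D₀ K k ^ (10 * K)) ≤ 10 * K * ((4 * k + 1) * Nat.log 2 n + 28 * k + 9) := by
    have h := log2_pow_le (D₀ K k) (10 * K)
    have h' := log2_D₀_le (k := k) hK1 hKn
    exact h.trans (Nat.mul_le_mul_left _ (by omega))
  -- assemble the product
  unfold A
  have p1 := log2_mul_le (2 * 10 ^ 8 * K * 2 ^ (20 * K) * (31 * K) ^ (31 * K) * (u + σ + 40 * K + 1) ^ (10 * K) * 2 ^ (10 * K))
    (D₀ K k ^ (10 * K))
  have p2 := log2_mul_le (2 * 10 ^ 8 * K * 2 ^ (20 * K) * (31 * K) ^ (31 * K) * (u + σ + 40 * K + 1) ^ (10 * K))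
    (2 ^ (10 * K))
  have p3 := log2_mul_le (2 * 10 ^ 8 * K * 2 ^ (20 * K) * (31 * K) ^ (31 * K)) ((u + σ + 40 * K + 1) ^ (10 * K))
  have p4 := log2_mul_le (2 * 10 ^ 8 * K * 2 ^ (20 * K)) ((31 * K) ^ (31 * K))
  have p5 := log2_mul_le (2 * 10 ^ 8 * K) (2 ^ (20 * K))
  have p6 := log2_mul_le (2 * 10 ^ 8) K
  have key : Nat.log 2 (2 * 10 ^ 8 * K * 2 ^ (20 * K) * (31 * K) ^ (31 * K) * (u + σ + 40 * K + 1) ^ (10 * K) *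
      2 ^ (10 * K) * D₀ K k ^ (10 * K)) ≤
      27 + Nat.log 2 n + 20 * K + 31 * K * (Nat.log 2 n + 6) + 10 * K * (Nat.log 2 n + 7) + 10 * K + 10 * K * ((4 * k + 1) * Nat.log 2 n + 28 * k + 9) + 6 := by
    omega
  refine key.trans (le_of_eq ?_)
  ring

/-- **`M' ≤ α_k · log₂ n + β_k`** with `α_k = 40k + 53`, `β_k = 400(k+1)² + 280k + 415`: the division
by `K + 1` in `M'` absorbs the factor `K` of `log₂ A`. [cite: Khot2005, §7.3] -/
theorem M'_le (hK1 : 1 ≤ K) (hKn : K ≤ n) (hu : u ≤ n) (hσ : σ ≤ n) :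
    M' u σ K k ≤ αk k * Nat.log 2 n + βk k := by
  have hA := log2_A_le (k := k) hK1 hKn hu hσ
  -- `(log₂ A + 1)/(K+1) ≤ T` with `T = (40k+51) log₂ n + 280k + 376`
  have hdiv : (Nat.log 2 (A u σ K k) + 1) / (K + 1) ≤ (40 * k + 51) * Nat.log 2 n + 280 * k + 376 := by
    refine (Nat.div_le_iff_le_mul_add_pred (by omega)).2 ?_
    have h2 : 34 + Nat.log 2 n ≤ (40 * k + 51) * Nat.log 2 n + 280 * k + 376 := by nlinarith
    calc Nat.log 2 (A u σ K k) + 1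
        ≤ 34 + Nat.log 2 n + K * ((40 * k + 51) * Nat.log 2 n + 280 * k + 376) := by omega
      _ ≤ ((40 * k + 51) * Nat.log 2 n + 280 * k + 376) + K * ((40 * k + 51) * Nat.log 2 n + 280 * k + 376) :=
          Nat.add_le_add_right h2 _
      _ = (K + 1) * ((40 * k + 51) * Nat.log 2 n + 280 * k + 376) := by ring
      _ ≤ (K + 1) * ((40 * k + 51) * Nat.log 2 n + 280 * k + 376) + (K + 1 - 1) := Nat.le_add_right _ _
  -- `log₂ (200·(31K)²) + 1 ≤ 2 log₂ n + 22`
  have hlog : Nat.log 2 (200 * (31 * K) ^ 2) + 1 ≤ 2 * Nat.log 2 n + 22 := by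
    have h := log2_le_of_le_mul (show 200 * (31 * K) ^ 2 ≤ 192200 * n ^ 2 by nlinarith [Nat.pow_le_pow_left hKn 2])
    have h192 : Nat.log 2 192200 < 18 := (Nat.log_lt_iff_lt_pow (by norm_num) (by norm_num)).2 (by norm_num)
    have h2 := log2_pow_le n 2
    omega
  unfold M'
  have hEp : 16 * Ep k ^ 2 + 16 = 400 * (k + 1) ^ 2 + 16 := by unfold Ep; ring
  rw [hEp]
  unfold αk βk
  have : (Nat.log 2 (A u σ K k) + 1) / (K + 1) + 1 + (400 * (k + 1) ^ 2 + 16) + (Nat.log 2 (200 * (31 * K) ^ 2) + 1) ≤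
      ((40 * k + 51) * Nat.log 2 n + 280 * k + 376) + 1 + (400 * (k + 1) ^ 2 + 16) + (2 * Nat.log 2 n + 22) := by omega
  refine this.trans (le_of_eq ?_)
  ring

/-- **`N ≤ 2^{2β_k} · n^{2α_k}`** (from `M'_le` and `2^{log₂ n} ≤ n`): the number of BCH columns is
polynomial of degree `2α_k = O(k)`. [cite: Khot2005, §7.3] -/
theorem NN_le (hK1 : 1 ≤ K) (hKn : K ≤ n) (hu : u ≤ n) (hσ : σ ≤ n) :
    NN u σ K k ≤ 2 ^ (2 * βk k) * n ^ (2 * αk k) := by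
  have hn : 1 ≤ n := hK1.trans hKn
  have hM := M'_le (k := k) hK1 hKn hu hσ
  unfold NN MM
  calc 2 ^ (2 * M' u σ K k) ≤ 2 ^ (2 * (αk k * Nat.log 2 n + βk k)) :=
        Nat.pow_le_pow_right (by norm_num) (Nat.mul_le_mul_left 2 hM)
    _ = 2 ^ (2 * βk k) * (2 ^ Nat.log 2 n) ^ (2 * αk k) := by rw [← pow_mul, ← pow_add]; ring_nf
    _ ≤ 2 ^ (2 * βk k) * n ^ (2 * αk k) :=
        Nat.mul_le_mul_left _ (Nat.pow_le_pow_left (Nat.pow_log_le_self 2 (by omega)) _)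

/-- `M + 1 = 2M' + 1 ≤ (2α_k + 2β_k + 1)·n` (crudely, `log₂ n ≤ n`, `n ≥ 1`). [folklore] -/
theorem MM_succ_le (hK1 : 1 ≤ K) (hKn : K ≤ n) (hu : u ≤ n) (hσ : σ ≤ n) :
    MM u σ K k + 1 ≤ (2 * αk k + 2 * βk k + 1) * n := by
  have hn : 1 ≤ n := hK1.trans hKn
  have hM := M'_le (k := k) hK1 hKn hu hσ
  have hl : Nat.log 2 n ≤ n := Nat.log_le_self 2 n
  unfold MM
  have : αk k * Nat.log 2 n ≤ αk k * n := Nat.mul_le_mul_left _ hl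
  nlinarith

/-- The row-count constant. [folklore] -/
def ρk (k : ℕ) : ℕ := 2 + 20 * (2 * αk k + 2 * βk k + 1) + 2 ^ (2 * βk k)

/-- **`rows ≤ ρ_k · n^{2α_k + 2}`**. [cite: Khot2005, §7.3] -/
theorem rows_le_poly (hK1 : 1 ≤ K) (hKn : K ≤ n) (hu : u ≤ n) (hσ : σ ≤ n) :
    rows u σ K k ≤ ρk k * n ^ (2 * αk k + 2) := by
  have hn : 1 ≤ n := hK1.trans hKn
  have hN := NN_le (k := k) hK1 hKn hu hσ
  have hM := MM_succ_le (k := k) hK1 hKn hu hσ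
  set E := 2 * αk k with hE
  have hE2 : 1 ≤ n ^ E := Nat.one_le_pow _ _ hn
  have hnE : n ≤ n ^ (E + 2) := by
    calc n = n ^ 1 := (pow_one n).symm
      _ ≤ n ^ (E + 2) := Nat.pow_le_pow_right hn (by omega)
  have hn2E : n * n ≤ n ^ (E + 2) := by
    calc n * n = n ^ 2 := by ring
      _ ≤ n ^ (E + 2) := Nat.pow_le_pow_right hn (by omega)
  have hNE : n ^ E ≤ n ^ (E + 2) := Nat.pow_le_pow_right hn (by omega)
  unfold rows hh ρk
  have h1 : 20 * K * (MM u σ K k + 1) ≤ 20 * (2 * αk k + 2 * βk k + 1) * (n * n) := by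
    calc 20 * K * (MM u σ K k + 1) ≤ 20 * n * ((2 * αk k + 2 * βk k + 1) * n) :=
          Nat.mul_le_mul (Nat.mul_le_mul_left 20 hKn) hM
      _ = 20 * (2 * αk k + 2 * βk k + 1) * (n * n) := by ring
  calc u + σ + 20 * K * (MM u σ K k + 1) + NN u σ K k
      ≤ n + n + 20 * (2 * αk k + 2 * βk k + 1) * (n * n) + 2 ^ (2 * βk k) * n ^ E := by
        gcongr
    _ ≤ n ^ (E + 2) + n ^ (E + 2) + 20 * (2 * αk k + 2 * βk k + 1) * n ^ (E + 2) + 2 ^ (2 * βk k) * n ^ (E + 2) := by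
        gcongr
    _ = (2 + 20 * (2 * αk k + 2 * βk k + 1) + 2 ^ (2 * βk k)) * n ^ (E + 2) := by ring

/-- The coefficient-bound constant. [folklore] -/
def sk (k : ℕ) : ℕ := 1258 + 961 * 20 * (2 * αk k + 2 * βk k + 1)

/-- **`s ≤ s_k · n^4`** (`s = K + 31K + h(31K)² + 1 + (35K)²`). [cite: Khot2005, §7.3] -/
theorem ss_le_poly (hK1 : 1 ≤ K) (hKn : K ≤ n) (hu : u ≤ n) (hσ : σ ≤ n) :
    ss u σ K k ≤ sk k * n ^ 4 := by
  have hn : 1 ≤ n := hK1.trans hKn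
  have hM := MM_succ_le (k := k) hK1 hKn hu hσ
  unfold ss hh sk
  set c := 2 * αk k + 2 * βk k + 1 with hc
  have h1 : 20 * K * (MM u σ K k + 1) * (31 * K) ^ 2 ≤ 961 * 20 * c * n ^ 4 := by
    calc 20 * K * (MM u σ K k + 1) * (31 * K) ^ 2 ≤ 20 * n * (c * n) * (31 * n) ^ 2 := by gcongr
      _ = 961 * 20 * c * n ^ 4 := by ring
  have h4 : n ≤ n ^ 4 := by
    calc n = n ^ 1 := (pow_one n).symm
      _ ≤ n ^ 4 := Nat.pow_le_pow_right hn (by omega)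
  have h24 : n ^ 2 ≤ n ^ 4 := Nat.pow_le_pow_right hn (by omega)
  have h14 : 1 ≤ n ^ 4 := Nat.one_le_pow _ _ hn
  calc K + (31 * K + 20 * K * (MM u σ K k + 1) * (31 * K) ^ 2) + 1 + (35 * K) ^ 2
      ≤ n + (31 * n + 961 * 20 * c * n ^ 4) + 1 + (35 * n) ^ 2 := by gcongr
    _ = n + 31 * n + 961 * 20 * c * n ^ 4 + 1 + 1225 * n ^ 2 := by ring
    _ ≤ n ^ 4 + 31 * n ^ 4 + 961 * 20 * c * n ^ 4 + n ^ 4 + 1225 * n ^ 4 := by gcongr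
    _ = (1258 + 961 * 20 * c) * n ^ 4 := by ring

/-- **`D ≤ (40 s_k)^{k+1} · n^{5(k+1)}`** (`D = s^k (40K)^{k+1}`). [cite: Khot2005, §7.3] -/
theorem DD_le_poly (hK1 : 1 ≤ K) (hKn : K ≤ n) (hu : u ≤ n) (hσ : σ ≤ n) :
    DD u σ K k ≤ (40 * sk k) ^ (k + 1) * n ^ (5 * (k + 1)) := by
  have hn : 1 ≤ n := hK1.trans hKn
  have hs := ss_le_poly (k := k) hK1 hKn hu hσ
  have hsk : 1 ≤ sk k := by unfold sk; omega
  unfold DD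
  calc ss u σ K k ^ k * (40 * K) ^ (k + 1) ≤ (sk k * n ^ 4) ^ k * (40 * n) ^ (k + 1) := by gcongr
    _ ≤ (sk k * n ^ 4) ^ (k + 1) * (40 * n) ^ (k + 1) := by
        refine Nat.mul_le_mul_right _ (Nat.pow_le_pow_right ?_ (Nat.le_succ k))
        exact Nat.mul_pos hsk (Nat.one_le_pow _ _ hn)
    _ = (40 * sk k) ^ (k + 1) * n ^ (5 * (k + 1)) := by
        rw [mul_pow, mul_pow, mul_pow, ← pow_mul]; ring

/-- **The bit size of the modulus**: `log₂ q₂ = ⌊log₂ q⌋ + 1 ≤ 20 + 10K·(log₂ rows + log₂ D + 4)`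
(`q ≤ 100 · (10K) · rows^{10K} · (2D)^{10K} · D`). [cite: Khot2005, §5.2.2 and §7.3] -/
theorem lq_le (hK1 : 1 ≤ K) :
    lq u σ K k ≤ 15 + Nat.log 2 K + 10 * K * (Nat.log 2 (rows u σ K k) + Nat.log 2 (DD u σ K k) + 4) +
      Nat.log 2 (DD u σ K k) := by
  unfold lq
  rw [qq_eq u σ K k hK1]
  unfold Abound
  rw [div_eq_L K hK1]
  set Lx := L K with hLx
  have hL : Lx + 1 = 10 * K := L_succ K hK1
  set R := rows u σ K k
  set D := DD u σ K k
  have h1 := log2_mul_le (100 * ((Lx + 1) * R ^ Lx * (2 * D) ^ Lx)) D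
  have h2 := log2_mul_le 100 ((Lx + 1) * R ^ Lx * (2 * D) ^ Lx)
  have h3 := log2_mul_le ((Lx + 1) * R ^ Lx) ((2 * D) ^ Lx)
  have h4 := log2_mul_le (Lx + 1) (R ^ Lx)
  have h5 := log2_pow_le R Lx
  have h6 := log2_pow_le (2 * D) Lx
  have h7 := log2_mul_le 2 D
  have h100 : Nat.log 2 100 = 6 := by decide
  have h2' : Nat.log 2 2 = 1 := by decide
  have h10 : Nat.log 2 (Lx + 1) ≤ Nat.log 2 K + 4 := by
    rw [hL]
    have := log2_mul_le 10 K
    have h10' : Nat.log 2 10 = 3 := by decide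
    omega
  have hLK : Lx ≤ 10 * K := by omega
  have e1 : Lx * (Nat.log 2 R + 1) ≤ 10 * K * (Nat.log 2 R + 1) := Nat.mul_le_mul_right _ hLK
  have e2 : Lx * (Nat.log 2 (2 * D) + 1) ≤ 10 * K * (Nat.log 2 D + 3) :=
    (Nat.mul_le_mul_right _ hLK).trans (Nat.mul_le_mul_left _ (by omega))
  have : Nat.log 2 (100 * ((Lx + 1) * R ^ Lx * (2 * D) ^ Lx) * D) ≤
      14 + Nat.log 2 K + 10 * K * (Nat.log 2 R + 1) + 10 * K * (Nat.log 2 D + 3) + Nat.log 2 D := by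
    omega
  calc Nat.log 2 (100 * ((Lx + 1) * R ^ Lx * (2 * D) ^ Lx) * D) + 1
      ≤ 14 + Nat.log 2 K + 10 * K * (Nat.log 2 R + 1) + 10 * K * (Nat.log 2 D + 3) + Nat.log 2 D + 1 := by omega
    _ = 15 + Nat.log 2 K + 10 * K * (Nat.log 2 R + Nat.log 2 D + 4) + Nat.log 2 D := by ring

/-- The bracket of the bit-size constant of the modulus. [folklore] -/
def Ck (k : ℕ) : ℕ := Nat.log 2 (ρk k) + (2 * αk k + 3) + (k + 1) * (Nat.log 2 (40 * sk k) + 1) + 5 * (k + 1) + 6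

/-- The bit-size constant of the modulus. [folklore] -/
def lamk (k : ℕ) : ℕ := 16 + 31 * Ck k

/-- **`log₂ q₂ ≤ λ_k · n · (log₂ n + 1)`**: the modulus has polynomially many bits.
[cite: Khot2005, §5.2.2 and §7.3] -/
theorem lq_le_poly (hK1 : 1 ≤ K) (hKn : K ≤ n) (hu : u ≤ n) (hσ : σ ≤ n) :
    lq u σ K k ≤ lamk k * n * (Nat.log 2 n + 1) := by
  have hn : 1 ≤ n := hK1.trans hKn
  have h0 := lq_le (u := u) (σ := σ) (k := k) hK1
  have hR : Nat.log 2 (rows u σ K k) ≤ Nat.log 2 (ρk k) + (2 * αk k + 2) * (Nat.log 2 n + 1) + 1 := by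
    have h := log2_le_of_le_mul (rows_le_poly (k := k) hK1 hKn hu hσ)
    have h' := log2_pow_le n (2 * αk k + 2)
    omega
  have hD : Nat.log 2 (DD u σ K k) ≤ (k + 1) * (Nat.log 2 (40 * sk k) + 1) + 5 * (k + 1) * (Nat.log 2 n + 1) + 1 := by
    have h := log2_le_of_le_mul (DD_le_poly (k := k) hK1 hKn hu hσ)
    have h' := log2_pow_le (40 * sk k) (k + 1)
    have h'' := log2_pow_le n (5 * (k + 1))
    omega
  have hKl : Nat.log 2 K ≤ Nat.log 2 n := Nat.log_mono_right hKn
  have hl1 : 1 ≤ Nat.log 2 n + 1 := by omega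
  have hR' : Nat.log 2 (rows u σ K k) ≤ Ck k * (Nat.log 2 n + 1) := by
    calc Nat.log 2 (rows u σ K k) ≤ Nat.log 2 (ρk k) + (2 * αk k + 2) * (Nat.log 2 n + 1) + 1 := hR
      _ ≤ Nat.log 2 (ρk k) * (Nat.log 2 n + 1) + (2 * αk k + 2) * (Nat.log 2 n + 1) + (Nat.log 2 n + 1) :=
          Nat.add_le_add (Nat.add_le_add_right (Nat.le_mul_of_pos_right _ hl1) _) hl1
      _ = (Nat.log 2 (ρk k) + (2 * αk k + 2) + 1) * (Nat.log 2 n + 1) := by ring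
      _ ≤ Ck k * (Nat.log 2 n + 1) := Nat.mul_le_mul_right _ (by unfold Ck; omega)
  have hD' : Nat.log 2 (DD u σ K k) ≤ Ck k * (Nat.log 2 n + 1) := by
    calc Nat.log 2 (DD u σ K k) ≤ (k + 1) * (Nat.log 2 (40 * sk k) + 1) + 5 * (k + 1) * (Nat.log 2 n + 1) + 1 := hD
      _ ≤ (k + 1) * (Nat.log 2 (40 * sk k) + 1) * (Nat.log 2 n + 1) + 5 * (k + 1) * (Nat.log 2 n + 1) + (Nat.log 2 n + 1) :=
          Nat.add_le_add (Nat.add_le_add_right (Nat.le_mul_of_pos_right _ hl1) _) hl1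
      _ = ((k + 1) * (Nat.log 2 (40 * sk k) + 1) + 5 * (k + 1) + 1) * (Nat.log 2 n + 1) := by ring
      _ ≤ Ck k * (Nat.log 2 n + 1) := Nat.mul_le_mul_right _ (by unfold Ck; omega)
  have h4 : (4 : ℕ) ≤ Ck k * (Nat.log 2 n + 1) :=
    calc (4 : ℕ) ≤ Ck k := by unfold Ck; omega
      _ ≤ Ck k * (Nat.log 2 n + 1) := Nat.le_mul_of_pos_right _ hl1
  have hmid : 10 * K * (Nat.log 2 (rows u σ K k) + Nat.log 2 (DD u σ K k) + 4) ≤ 10 * n * (3 * (Ck k * (Nat.log 2 n + 1))) :=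
    Nat.mul_le_mul (Nat.mul_le_mul_left 10 hKn) (by omega)
  have hnl : Nat.log 2 n + 1 ≤ n * (Nat.log 2 n + 1) := Nat.le_mul_of_pos_left _ hn
  have h12 : 15 + Nat.log 2 K ≤ 16 * (n * (Nat.log 2 n + 1)) := by omega
  have hC1 : Ck k * (Nat.log 2 n + 1) ≤ n * (Ck k * (Nat.log 2 n + 1)) := Nat.le_mul_of_pos_left _ hn
  unfold lamk
  calc lq u σ K k ≤ 15 + Nat.log 2 K + 10 * K * (Nat.log 2 (rows u σ K k) + Nat.log 2 (DD u σ K k) + 4) +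
        Nat.log 2 (DD u σ K k) := h0
    _ ≤ 16 * (n * (Nat.log 2 n + 1)) + 10 * n * (3 * (Ck k * (Nat.log 2 n + 1))) + n * (Ck k * (Nat.log 2 n + 1)) := by
        omega
    _ = (16 + 31 * Ck k) * n * (Nat.log 2 n + 1) := by ring

/-- The coin-budget constant. [folklore] -/
def Lk (k : ℕ) : ℕ := 62 * (αk k + βk k) + 2 * (ρk k * lamk k)

/-- **The number of coins read is polynomial**: `L₀ ≤ L_k · n^{2α_k + 5}` for `u, σ, K ≤ n`,
`K ≥ 1`. [cite: Khot2005, §7.3] -/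
theorem L₀_le_poly (hK1 : 1 ≤ K) (hKn : K ≤ n) (hu : u ≤ n) (hσ : σ ≤ n) :
    L₀ u σ K k ≤ Lk k * n ^ (2 * αk k + 5) := by
  have hn : 1 ≤ n := hK1.trans hKn
  have hM := M'_le (k := k) hK1 hKn hu hσ
  have hrows := rows_le_poly (k := k) hK1 hKn hu hσ
  have hlq := lq_le_poly (k := k) hK1 hKn hu hσ
  have hl : Nat.log 2 n ≤ n := Nat.log_le_self 2 n
  have hl1 : Nat.log 2 n + 1 ≤ 2 * n := by omega
  unfold L₀ Lg MM Lk
  -- first summand: `31K · 2M' ≤ 62 (α+β) n²`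
  have h1 : 31 * K * (2 * M' u σ K k) ≤ 62 * (αk k + βk k) * n ^ 2 := by
    have : M' u σ K k ≤ (αk k + βk k) * n := by nlinarith
    calc 31 * K * (2 * M' u σ K k) ≤ 31 * n * (2 * ((αk k + βk k) * n)) := by gcongr
      _ = 62 * (αk k + βk k) * n ^ 2 := by ring
  -- second summand: `rows · lq ≤ 2 ρ λ n^{E+4}`
  have h2 : rows u σ K k * lq u σ K k ≤ 2 * (ρk k * lamk k) * n ^ (2 * αk k + 4) := by
    calc rows u σ K k * lq u σ K k ≤ (ρk k * n ^ (2 * αk k + 2)) * (lamk k * n * (Nat.log 2 n + 1)) := Nat.mul_le_mul hrows hlq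
      _ ≤ (ρk k * n ^ (2 * αk k + 2)) * (lamk k * n * (2 * n)) := by gcongr
      _ = 2 * (ρk k * lamk k) * n ^ (2 * αk k + 4) := by ring
  have hn2 : n ^ 2 ≤ n ^ (2 * αk k + 5) := Nat.pow_le_pow_right hn (by omega)
  have hn4 : n ^ (2 * αk k + 4) ≤ n ^ (2 * αk k + 5) := Nat.pow_le_pow_right hn (by omega)
  calc 31 * K * (2 * M' u σ K k) + rows u σ K k * lq u σ K k
      ≤ 62 * (αk k + βk k) * n ^ 2 + 2 * (ρk k * lamk k) * n ^ (2 * αk k + 4) := Nat.add_le_add h1 h2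
    _ ≤ 62 * (αk k + βk k) * n ^ (2 * αk k + 5) + 2 * (ρk k * lamk k) * n ^ (2 * αk k + 5) :=
        Nat.add_le_add (Nat.mul_le_mul_left _ hn2) (Nat.mul_le_mul_left _ hn4)
    _ = (62 * (αk k + βk k) + 2 * (ρk k * lamk k)) * n ^ (2 * αk k + 5) := by ring

end Params






/-! ### Code lengths: the sizes are bounded by the length of the instance code -/

section CodeLength

open Literature.Computability.Complexity

/-- `|unaryEncodeNat m| = m`. [folklore] -/
theorem length_unaryEncodeNat : ∀ m : ℕ, (unaryEncodeNat m).length = m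
  | 0 => rfl
  | m + 1 => by rw [unaryEncodeNat, List.length_cons, length_unaryEncodeNat m]

/-- The `listBool` code of a list is at least as long as the total length of the codes of its
members plus `2` per member. [cite: AroraBarak2009, §0.1] -/
theorem sum_length_le_length_listBool {α : Type} (e : Encoding α Bool) (l : List α) :
    (l.map fun a => (e.encode a).length + 2).sum ≤ (e.listBool.encode l).length := by
  show (l.map fun a => (e.encode a).length + 2).sum ≤
    (boolPair (unaryEncodeNat l.length) (l.foldr (fun a acc => boolPair (e.encode a) acc) [])).length
  rw [length_boolPair]
  suffices h : ∀ l : List α, (l.map fun a => (e.encode a).length + 2).sum ≤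
      (l.foldr (fun a acc => boolPair (e.encode a) acc) []).length by
    have := h l; omega
  intro l
  induction l with
  | nil => simp
  | cons a l ih =>
    simp only [List.map_cons, List.sum_cons, List.foldr_cons, length_boolPair]
    omega

/-- A list is at most as long as its `listBool` code. [cite: AroraBarak2009, §0.1] -/
theorem length_le_length_listBool {α : Type} (e : Encoding α Bool) (l : List α) :
    l.length ≤ (e.listBool.encode l).length := by
  refine le_trans ?_ (sum_length_le_length_listBool e l)
  induction l with
  | nil => simp
  | cons a l ih => simp only [List.length_cons, List.map_cons, List.sum_cons]; omega

/-- The total number of listed elements is at most the length of the code of the list of sets.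
[cite: AroraBarak2009, §0.1] -/
theorem length_flatten_le_length_code (sets : List (List ℕ)) :
    sets.flatten.length ≤ (encodingNatBool.listBool.listBool.encode sets).length := by
  refine le_trans ?_ (sum_length_le_length_listBool encodingNatBool.listBool sets)
  rw [List.length_flatten]
  induction sets with
  | nil => simp
  | cons S sets ih =>
    simp only [List.map_cons, List.sum_cons]
    have := length_le_length_listBool encodingNatBool S
    omega

/-- The code of a set cover instance, unfolded. [folklore] -/
theorem encode_eq (I : SetCoverInstance) : SetCoverInstance.encoding.encode I =
    boolPair (encodeNat I.univSize) (boolPair (encodingNatBool.listBool.listBool.encode I.sets) (encodeNat I.K)) :=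
  rfl

/-- **On the guard, all sizes are bounded by the code length**: `u, m, K ≤ |code I|` (and `K ≥ 1`);
`u ≤ |code I|` because every element of the universe is listed in some set. [cite: AroraBarak2009, §0.1] -/
theorem guard_sizes_le {I : SetCoverInstance} (hG : Guard I) :
    I.univSize ≤ (SetCoverInstance.encoding.encode I).length ∧
      I.sets.length ≤ (SetCoverInstance.encoding.encode I).length ∧
      I.K ≤ (SetCoverInstance.encoding.encode I).length ∧ 1 ≤ I.K := by
  obtain ⟨hK1, hKm, -, hcov⟩ := hG
  have hlen : (encodingNatBool.listBool.listBool.encode I.sets).length ≤ (SetCoverInstance.encoding.encode I).length := by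
    rw [encode_eq, length_boolPair, length_boolPair]; omega
  have hm : I.sets.length ≤ (SetCoverInstance.encoding.encode I).length :=
    (length_le_length_listBool _ _).trans hlen
  refine ⟨?_, hm, hKm.trans hm, hK1⟩
  -- every `e < u` is listed: `range u ⊆ (flatten sets).toFinset`
  have hsub : Finset.range I.univSize ⊆ I.sets.flatten.toFinset := fun e he => by
    rw [List.mem_toFinset, List.mem_flatten]
    obtain ⟨j, hj, hej⟩ := hcov e (Finset.mem_range.1 he)
    refine ⟨I.sets[j], List.getElem_mem hj, ?_⟩
    have h' : I.subsetAt j = I.sets[j] := by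
      unfold SetCoverInstance.subsetAt
      rw [List.getD_eq_getElem?_getD, List.getElem?_eq_getElem hj, Option.getD_some]
    rwa [h'] at hej
  calc I.univSize = (Finset.range I.univSize).card := (Finset.card_range _).symm
    _ ≤ I.sets.flatten.toFinset.card := Finset.card_le_card hsub
    _ ≤ I.sets.flatten.length := List.toFinset_card_le _
    _ ≤ (encodingNatBool.listBool.listBool.encode I.sets).length := length_flatten_le_length_code _
    _ ≤ (SetCoverInstance.encoding.encode I).length := hlen

end CodeLength

/-! ### The coin budget discharged -/

section Budget

open Params Polynomial

/-- **A polynomial coin budget exists**: for every `k`, `L₀ ≤ L_k · |code I|^{2α_k+5}` on the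
guard. [cite: Khot2005, §7.3] -/
theorem exists_coinBudget (k : ℕ) : ∃ Q : Polynomial ℕ, ∀ I : SetCoverInstance, Guard I →
    L₀ I.univSize I.sets.length I.K k ≤ Q.eval (SetCoverInstance.encoding.encode I).length := by
  refine ⟨C (Lk k) * X ^ (2 * αk k + 5), fun I hG => ?_⟩
  obtain ⟨hu, hσ, hK, hK1⟩ := guard_sizes_le hG
  simpa only [eval_mul, eval_C, eval_pow, eval_X] using L₀_le_poly hK1 hK hu hσ

/-- **Khot's randomised reduction from gap set cover to `GapSVP_{γ₀}`, given only the machine for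
the output map** (the coin-budget clause of `promiseRandReducible_gapSetCover_gapSVP_of_FP`
discharged by `exists_coinBudget`). [cite: Khot2005, Thm. 1.1, Thm. 5.1 and §7.3] -/
theorem promiseRandReducible_gapSetCover_gapSVP_of_FP' {γ₀ : ℝ} (hγ₀ : 1 ≤ γ₀) {k : ℕ}
    (hk : 8 * γ₀ ^ 2 < (8 / 7 : ℝ) ^ k) (Δ : KhotData k) {F : List Bool → List Bool} (hF : F ∈ FP)
    (hFI : ∀ (I : SetCoverInstance) (c : List Bool),
      F (boolPair (SetCoverInstance.encoding.encode I) c) = GapSVPInstance.encode (khotOutput k Δ I c)) :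
    PromiseRandReducible (gapSetCover 40) (gapSVPPromise fun _ => γ₀) := by
  obtain ⟨Q, hQ⟩ := exists_coinBudget k
  exact promiseRandReducible_gapSetCover_gapSVP_of_FP hγ₀ hk Δ hF hQ hFI

/-- **`gapSVP_const_isNPHardRandomized` from the PCP-based gap set cover hardness and the machine
for the output map alone.** The target named fact (pqc.S17) follows from `AroraEtAl1997_prop6` and
the implementation statement: for every `k`, some `F ∈ FP` computes
`⟨code I, c⟩ ↦ code (khotOutput k Δ I c)` for some admissible data `Δ` (Khot 2005, §7.3: "a
reduction that runs in time `n^{O(k²)}`", on the tree's TM2 model — the one remaining,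
machine-level, obligation). [cite: Khot2005, Thm. 1.1 and §7.3] -/
theorem gapSVP_const_isNPHardRandomized_of_prop6_of_FP' (h₁ : AroraEtAl1997_prop6)
    (h₂ : ∀ k : ℕ, ∃ (Δ : KhotData k) (F : List Bool → List Bool), F ∈ FP ∧
      ∀ (I : SetCoverInstance) (c : List Bool),
        F (boolPair (SetCoverInstance.encoding.encode I) c) = GapSVPInstance.encode (khotOutput k Δ I c)) :
    gapSVP_const_isNPHardRandomized := by
  refine gapSVP_const_isNPHardRandomized_of_gapSetCover_forty h₁ fun γ₀ hγ₀ => ?_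
  obtain ⟨k, hk⟩ := exists_levels γ₀
  obtain ⟨Δ, F, hF, hFI⟩ := h₂ k
  exact promiseRandReducible_gapSetCover_gapSVP_of_FP' hγ₀ hk Δ hF hFI

/-- Pointwise form: randomised NP-hardness of `GapSVP_{γ₀}` from the machine for ONE `k` with
`8γ₀² < (8/7)^k`. [cite: Khot2005, Thm. 1.1 and §7.3] -/
theorem isNPHardRandomized_gapSVP_of_prop6_of_FP' (h₁ : AroraEtAl1997_prop6) {γ₀ : ℝ} (hγ₀ : 1 ≤ γ₀)
    {k : ℕ} (hk : 8 * γ₀ ^ 2 < (8 / 7 : ℝ) ^ k) (Δ : KhotData k) {F : List Bool → List Bool} (hF : F ∈ FP)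
    (hFI : ∀ (I : SetCoverInstance) (c : List Bool),
      F (boolPair (SetCoverInstance.encoding.encode I) c) = GapSVPInstance.encode (khotOutput k Δ I c)) :
    (gapSVPPromise fun _ => γ₀).IsNPHardRandomized :=
  isNPHardRandomized_gapSVP_of_gapSetCover h₁ (by norm_num)
    (promiseRandReducible_gapSetCover_gapSVP_of_FP' hγ₀ hk Δ hF hFI)

end Budget


open Params

/-! ### Explicit enumerations of the recursive index types -/

section Enumerations

variable {m n : Type} {r c d : ℕ}

/-- `Coef n j ≃ Fin (c^{j+1})` from `n ≃ Fin c` (mixed radix, first factor most significant).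
[cite: Khot2005, §6] -/
def coefEquivFin (en : n ≃ Fin c) : ∀ j : ℕ, Coef n j ≃ Fin (c ^ (j + 1))
  | 0 => en.trans (finCongr (pow_one c).symm)
  | j + 1 => (Equiv.prodCongr en (coefEquivFin en j)).trans (finProdFinEquiv.trans (finCongr (by ring)))

/-- The number of rows of the level-`j` boosted matrix: `outCard r c 0 = r`,
`outCard r c (j+1) = r·c^{j+1} + r·outCard r c j`. [cite: Khot2005, §6] -/
def outCard (r c : ℕ) : ℕ → ℕ
  | 0 => r
  | j + 1 => r * c ^ (j + 1) + r * outCard r c j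

/-- `Out m n j ≃ Fin (outCard r c j)` from `m ≃ Fin r`, `n ≃ Fin c` (the `αBx_i` blocks first, then
the `B x B_jᵀ` block). [cite: Khot2005, §6] -/
def outEquivFin (em : m ≃ Fin r) (en : n ≃ Fin c) : ∀ j : ℕ, Out m n j ≃ Fin (outCard r c j)
  | 0 => em
  | j + 1 =>
    (Equiv.sumCongr ((Equiv.prodCongr em (coefEquivFin en j)).trans finProdFinEquiv)
      ((Equiv.prodCongr em (outEquivFin em en j)).trans finProdFinEquiv)).trans finSumFinEquiv

/-- The number of padding rows at level `j`: `padCard r c d 0 = d`,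
`padCard r c d (j+1) = d·c^{j+1} + r·outCard r c j`. [folklore] -/
def padCard (r c d : ℕ) : ℕ → ℕ
  | 0 => d
  | j + 1 => d * c ^ (j + 1) + r * outCard r c j

/-- The padding rows of level `j + 1` split along the two summands of `Out m n (j+1)`.
[folklore] -/
def augPadSuccEquiv (p₀ : m → Prop) (j : ℕ) :
    {o : Out m n (j + 1) // augPad (n := n) p₀ (j + 1) o} ≃ ({rc : m × Coef n j // p₀ rc.1} ⊕ (m × Out m n j)) where
  toFun o := match o with
    | ⟨Sum.inl rc, h⟩ => Sum.inl ⟨rc, h⟩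
    | ⟨Sum.inr mo, _⟩ => Sum.inr mo
  invFun s := match s with
    | Sum.inl ⟨rc, h⟩ => ⟨Sum.inl rc, h⟩
    | Sum.inr mo => ⟨Sum.inr mo, trivial⟩
  left_inv o := by rcases o with ⟨rc | mo, h⟩ <;> rfl
  right_inv s := by rcases s with ⟨rc, h⟩ | mo <;> rfl

/-- `{o : Out m n j // augPad p₀ j o} ≃ Fin (padCard r c d j)` from `m ≃ Fin r`, `n ≃ Fin c`,
`{x // p₀ x} ≃ Fin d`. [folklore] -/
def padEquivFin (em : m ≃ Fin r) (en : n ≃ Fin c) {p₀ : m → Prop} (ep : {x : m // p₀ x} ≃ Fin d) :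
    ∀ j : ℕ, {o : Out m n j // augPad (n := n) p₀ j o} ≃ Fin (padCard r c d j)
  | 0 => ep
  | j + 1 =>
    (augPadSuccEquiv p₀ j).trans
      ((Equiv.sumCongr
        (((Equiv.prodSubtypeFstEquivSubtypeProd (p := p₀)).trans (Equiv.prodCongr ep (coefEquivFin en j))).trans
          finProdFinEquiv)
        ((Equiv.prodCongr em (outEquivFin em en j)).trans finProdFinEquiv)).trans finSumFinEquiv)

/-- The counting identity behind `eC`: `c^{j+1} + padCard r c d j = outCard r c j` when
`c + d = r`. [folklore] -/
theorem pow_add_padCard (h : c + d = r) : ∀ j : ℕ, c ^ (j + 1) + padCard r c d j = outCard r c j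
  | 0 => by simp [padCard, outCard, ← h]
  | j + 1 => by
    simp only [padCard, outCard]
    have := pow_add_padCard h j
    rw [← h]
    ring

end Enumerations

/-! ### The explicit base enumerations -/

section Base

variable (u σ K k : ℕ)

/-- The rows of the base basis (`RowsT` then the extra row of §5.2.2) as `Fin (rows + 1)`.
[cite: Khot2005, §5.2.2] -/
def rowsUnitEquivFin : (RowsT u σ K k ⊕ Unit) ≃ Fin (rows u σ K k + 1) :=
  (Equiv.sumCongr (idxR u σ K k) finOneEquiv.symm).trans finSumFinEquiv

/-- The number of columns of the base basis: `σ + (N + h) + 1 + 1`. [cite: Khot2005, §5.1–5.2] -/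
def cols : ℕ := σ + (NN u σ K k + hh u σ K k) + 1 + 1

/-- The columns of the base basis (`ColsT`: sets, then columns, then BCH rows `(a, b) ↦ b + (M+1)a`,
then the target column, then the extra column) as `Fin cols`. [cite: Khot2005, §5.1–5.2] -/
def colsEquivFin : ColsT u σ K k ≃ Fin (cols u σ K k) :=
  (Equiv.sumCongr
    ((Equiv.sumCongr
      ((Equiv.sumCongr (Equiv.refl (Fin σ))
        ((Equiv.sumCongr (Equiv.refl (Fin (NN u σ K k))) (finProdFinEquiv.trans (finCongr (by unfold hh; ring)))).trans
          finSumFinEquiv)).trans finSumFinEquiv)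
      finOneEquiv.symm).trans finSumFinEquiv)
    finOneEquiv.symm).trans finSumFinEquiv

variable {u}

/-- The padding rows of the base: the universe rows `e ≠ 0`, as `Fin (u - 1)` by `e ↦ e - 1`.
[folklore] -/
def basePadEquivFin (hu : 1 ≤ u) :
    {i : RowsT u σ K k ⊕ Unit // basePad (S := Fin σ) (H := Fin (20 * K) × Fin (MM u σ K k + 1))
      (Nn := Fin (NN u σ K k)) (⟨0, hu⟩ : Fin u) i} ≃ Fin (u - 1) where
  toFun i := match i with
    | ⟨Sum.inl (Sum.inl (Sum.inl e)), h⟩ => ⟨(e : ℕ) - 1, by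
        obtain ⟨e', he', hne⟩ := h
        cases he'
        have h0 : (e : ℕ) ≠ 0 := fun h0 => hne (Fin.ext h0)
        have := e.isLt
        omega⟩
    | ⟨Sum.inl (Sum.inl (Sum.inr _)), h⟩ => absurd h (by rintro ⟨e', he', -⟩; cases he')
    | ⟨Sum.inl (Sum.inr _), h⟩ => absurd h (by rintro ⟨e', he', -⟩; cases he')
    | ⟨Sum.inr _, h⟩ => absurd h (by rintro ⟨e', he', -⟩; cases he')
  invFun i := ⟨Sum.inl (Sum.inl (Sum.inl ⟨(i : ℕ) + 1, by omega⟩)),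
    ⟨⟨(i : ℕ) + 1, by omega⟩, rfl, fun h => by have := congrArg Fin.val h; simp at this⟩⟩
  left_inv i := by
    rcases i with ⟨((e | s) | hn) | t, h⟩
    · obtain ⟨e', he', hne⟩ := h
      cases he'
      have h0 : (e : ℕ) ≠ 0 := fun h0 => hne (Fin.ext h0)
      apply Subtype.ext
      simp only
      congr 3
      apply Fin.ext
      simp only
      omega
    · exact absurd h (by rintro ⟨e', he', -⟩; cases he')
    · exact absurd h (by rintro ⟨e', he', -⟩; cases he')
    · exact absurd h (by rintro ⟨e', he', -⟩; cases he')
  right_inv i := by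
    apply Fin.ext
    simp

variable (u)

/-- `cols + (u - 1) = rows + 1` (for `u ≥ 1`). [folklore] -/
theorem cols_add (hu : 1 ≤ u) : cols u σ K k + (u - 1) = rows u σ K k + 1 := by
  unfold cols rows; omega

/-- The output dimension for the explicit data. [cite: Khot2005, §7.3] -/
def NfExplicit : ℕ := outCard (rows u σ K k + 1) (cols u σ K k) k

end Base

/-! ### The explicit data and the explicit output map -/

section Explicit

/-- **The explicit admissible data**: BCH blocks `khotBCH` and the enumerations above.
[cite: Khot2005, Thm. 4.1 and §7.3] -/
def khotDataExplicit (k : ℕ) : KhotData k where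
  P u σ K := khotBCH u σ K k
  P01 u σ K := khotBCH_entry u σ K k
  dwise u σ K := khotBCH_dwise u σ K k
  Nf u σ K := NfExplicit u σ K k
  eR u σ K := outEquivFin (rowsUnitEquivFin u σ K k) (colsEquivFin u σ K k) k
  eC u σ K hu :=
    (Equiv.sumCongr (coefEquivFin (colsEquivFin u σ K k) k)
      (padEquivFin (rowsUnitEquivFin u σ K k) (colsEquivFin u σ K k) (basePadEquivFin σ K k hu) k)).trans
      (finSumFinEquiv.trans (finCongr (pow_add_padCard (cols_add u σ K k hu) k)))

/-- **The explicit total output map of Khot's reduction** with `k` levels: `khotOutput` for the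
explicit data. [cite: Khot2005, §7.3] -/
def khotOutputExplicit (k : ℕ) : SetCoverInstance → List Bool → GapSVPInstance :=
  khotOutput k (khotDataExplicit k)

/-- **Khot's randomised reduction `gapSetCover 40 → GapSVP_{γ₀}` from a machine for the explicit
map** (`k` with `8γ₀² < (8/7)^k`). [cite: Khot2005, Thm. 1.1 and §7.3] -/
theorem promiseRandReducible_gapSetCover_gapSVP_of_FP_explicit {γ₀ : ℝ} (hγ₀ : 1 ≤ γ₀) {k : ℕ}
    (hk : 8 * γ₀ ^ 2 < (8 / 7 : ℝ) ^ k) {F : List Bool → List Bool} (hF : F ∈ FP)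
    (hFI : ∀ (I : SetCoverInstance) (c : List Bool),
      F (boolPair (SetCoverInstance.encoding.encode I) c) = GapSVPInstance.encode (khotOutputExplicit k I c)) :
    PromiseRandReducible (gapSetCover 40) (gapSVPPromise fun _ => γ₀) :=
  promiseRandReducible_gapSetCover_gapSVP_of_FP' hγ₀ hk (khotDataExplicit k) hF hFI

/-- **`gapSVP_const_isNPHardRandomized` from the PCP-based gap set cover hardness and a machine for
ONE explicit map per `k`.** The target named fact (`LatticeComplexity.lean`, pqc.S17) follows from
`AroraEtAl1997_prop6` and: for every `k`, some `F ∈ FP` satisfies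
`F ⟨code I, c⟩ = code (khotOutputExplicit k I c)` for all set cover instances `I` and bit strings
`c` — Khot 2005, §7.3 ("a reduction that runs in time `n^{O(k²)}`") for the completely specified
map `khotOutputExplicit k`, on the tree's TM2 model; the one remaining obligation of the cone of
the fact. [cite: Khot2005, Thm. 1.1 and §7.3] -/
theorem gapSVP_const_isNPHardRandomized_of_prop6_of_FP_explicit (h₁ : AroraEtAl1997_prop6)
    (h₂ : ∀ k : ℕ, ∃ F : List Bool → List Bool, F ∈ FP ∧
      ∀ (I : SetCoverInstance) (c : List Bool),
        F (boolPair (SetCoverInstance.encoding.encode I) c) = GapSVPInstance.encode (khotOutputExplicit k I c)) :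
    gapSVP_const_isNPHardRandomized :=
  gapSVP_const_isNPHardRandomized_of_prop6_of_FP' h₁ fun k => by
    obtain ⟨F, hF, hFI⟩ := h₂ k
    exact ⟨khotDataExplicit k, F, hF, hFI⟩

/-- Pointwise form: randomised NP-hardness of `GapSVP_{γ₀}` from a machine for the explicit map with
ONE `k`, `8γ₀² < (8/7)^k`. [cite: Khot2005, Thm. 1.1 and §7.3] -/
theorem isNPHardRandomized_gapSVP_of_prop6_of_FP_explicit (h₁ : AroraEtAl1997_prop6) {γ₀ : ℝ}
    (hγ₀ : 1 ≤ γ₀) {k : ℕ} (hk : 8 * γ₀ ^ 2 < (8 / 7 : ℝ) ^ k) {F : List Bool → List Bool} (hF : F ∈ FP)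
    (hFI : ∀ (I : SetCoverInstance) (c : List Bool),
      F (boolPair (SetCoverInstance.encoding.encode I) c) = GapSVPInstance.encode (khotOutputExplicit k I c)) :
    (gapSVPPromise fun _ => γ₀).IsNPHardRandomized :=
  isNPHardRandomized_gapSVP_of_prop6_of_FP' h₁ hγ₀ hk (khotDataExplicit k) hF hFI

end Explicit

end Literature.Algebra.EuclideanLattices.Khot
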